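import Literature.AlgebraicGeometry.Resolution.QuadraticTransforms
import Literature.AlgebraicGeometry.Resolution.DerivativeIdealsLocalization
import Mathlib.RingTheory.Localization.FractionRing
import Mathlib.RingTheory.Derivation.Basic

/-!
# Logarithmic derivations extend to the quadratic transform along a valuation

Helper file for the stub `exists_derivation_quadraticTransformAlong` (sub-goal H4) of the line
`pfaff-line-log-final-forms` (crux `Valuative.LuAlphaPTorsor`, item
`stmt-ResolutionOfSingularities-0641`).

Setting: `K` a field, `O ⊆ K` a valuation ring, `R ⊆ K` a local subring and `R₁` the quadratic
transform of `R` along `O` (`IsQuadraticTransformAlong O R R₁`, i.e.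
`R₁ = (R[𝔪/u₀])_{𝔪_O ∩ R[𝔪/u₀]}` for a generator `u₀` of `𝔪 = 𝔪_R` of minimal value). A
`ℤ`-derivation `δ` of `R` which is logarithmic at the closed point (`δ 𝔪 ⊆ 𝔪`) extends to a
`ℤ`-derivation `δ₁` of `R₁`:

* extend `δ` to the fraction field `F = Frac R` (`exists_derivation_extend_of_isLocalization`)
  and map `F → K` by `j = IsFractionRing.lift`;
* the elements `w ∈ F` with `j w ∈ R₁` and `j (δ_F w) ∈ R₁` form a subring `T` of `F`
  (`exists_subring_forall_mem_iff`) closed under quotients whose denominator is a unit of `R₁`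
  (`div_mem_and`);
* `T ∋ r` (`r ∈ R`) and `T ∋ y/u₀` (`y ∈ 𝔪`) because
  `δ_F (y/u₀) = δ y / u₀ - (y/u₀) · (δ u₀ / u₀)` with `δ y, δ u₀ ∈ 𝔪`; hence `j T ⊇ R[𝔪/u₀]` and,
  by the quotient rule, `j T ⊇ R₁` (`forall_exists_of_mem_locAtCentre`);
* so `z = j w ↦ j (δ_F w)` is a well defined derivation of `R₁` extending `δ`
  (`exists_derivation_of_forall_exists`). [folklore]
-/

set_option linter.dupNamespace false

namespace Summit.ResolutionOfSingularities.ResolutionOfSingularities.Theorems.PfaffLine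

open IsLocalRing Literature.AlgebraicGeometry.Resolution

section Generic

variable {S : Type*} [CommRing S] {F : Type*} [Field F] [Algebra S F] {K : Type*} [Field K]

/-- For a derivation `D` of a field `F`, a ring map `j : F → K` and a subring `R₁ ⊆ K`: the
elements `w ∈ F` with `j w ∈ R₁` and `j (D w) ∈ R₁` form a subring `T` of `F` (Leibniz rule).
Stated as an existence so that this helper file introduces no definitions. [folklore] -/
private theorem exists_subring_forall_mem_iff (j : F →+* K) (D : Derivation S F F)
    (R₁ : Subring K) : ∃ T : Subring F, ∀ w : F, w ∈ T ↔ j w ∈ R₁ ∧ j (D w) ∈ R₁ :=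
  ⟨{ carrier := {w | j w ∈ R₁ ∧ j (D w) ∈ R₁},
     mul_mem' := fun {a b} ha hb => by
       refine ⟨by rw [map_mul]; exact mul_mem ha.1 hb.1, ?_⟩
       rw [Derivation.leibniz, smul_eq_mul, smul_eq_mul, map_add, map_mul, map_mul]
       exact add_mem (mul_mem ha.1 hb.2) (mul_mem hb.1 ha.2),
     one_mem' := ⟨by rw [map_one]; exact one_mem _,
       by rw [Derivation.map_one_eq_zero, map_zero]; exact zero_mem _⟩,
     add_mem' := fun {a b} ha hb =>
       ⟨by rw [map_add]; exact add_mem ha.1 hb.1,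
         by rw [map_add, map_add]; exact add_mem ha.2 hb.2⟩,
     zero_mem' := ⟨by rw [map_zero]; exact zero_mem _,
       by rw [map_zero, map_zero]; exact zero_mem _⟩,
     neg_mem' := fun {a} ha =>
       ⟨by rw [map_neg]; exact neg_mem ha.1, by rw [map_neg, map_neg]; exact neg_mem ha.2⟩ },
    fun _ => Iff.rfl⟩

/-- The quotient rule `D (a/b) = (b D a - a D b)/b²`: if `j a, j (D a), j b, j (D b) ∈ R₁` and
`(j b)⁻¹ ∈ R₁` then `j (a/b), j (D (a/b)) ∈ R₁`. [folklore] -/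
private theorem div_mem_and {j : F →+* K} {D : Derivation S F F} {R₁ : Subring K} {a b : F}
    (ha : j a ∈ R₁ ∧ j (D a) ∈ R₁) (hb : j b ∈ R₁ ∧ j (D b) ∈ R₁) (hb' : (j b)⁻¹ ∈ R₁) :
    j (a / b) ∈ R₁ ∧ j (D (a / b)) ∈ R₁ := by
  refine ⟨by rw [map_div₀, div_eq_mul_inv]; exact mul_mem ha.1 hb', ?_⟩
  rw [Derivation.leibniz_div]
  simp only [smul_eq_mul, map_mul, map_pow, map_inv₀, map_sub]
  exact mul_mem (pow_mem hb' 2) (sub_mem (mul_mem hb.1 ha.2) (mul_mem ha.1 hb.2))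

/-- If every element `z` of `R₁` is `j w` for some `w ∈ F` with `j (D w) ∈ R₁`, then
`z = j w ↦ j (D w)` is a well defined `ℤ`-derivation of `R₁` (`j` is injective). [folklore] -/
private theorem exists_derivation_of_forall_exists (j : F →+* K) (D : Derivation S F F)
    (R₁ : Subring K) (key : ∀ z : R₁, ∃ w : F, j (D w) ∈ R₁ ∧ j w = z) :
    ∃ δ₁ : Derivation ℤ R₁ R₁, ∀ (z : R₁) (w : F), j w = z → (δ₁ z : K) = j (D w) := by
  choose φ hφ' hφ using key
  have hji : Function.Injective j := j.injective
  have φadd : ∀ a b : R₁, φ (a + b) = φ a + φ b := fun a b =>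
    hji (by rw [map_add, hφ, hφ, hφ, Subring.coe_add])
  have φmul : ∀ a b : R₁, φ (a * b) = φ a * φ b := fun a b =>
    hji (by rw [map_mul, hφ, hφ, hφ, Subring.coe_mul])
  let D₀ : R₁ →+ R₁ := AddMonoidHom.mk' (fun z => ⟨j (D (φ z)), hφ' z⟩) fun a b =>
    Subtype.ext (by
      change j (D (φ (a + b))) = j (D (φ a)) + j (D (φ b))
      rw [φadd, map_add, map_add])
  refine ⟨Derivation.mk' D₀.toIntLinearMap fun a b => Subtype.ext ?_, fun z w hw => ?_⟩
  · change j (D (φ (a * b))) = (a : K) * j (D (φ b)) + (b : K) * j (D (φ a))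
    rw [φmul, Derivation.leibniz, smul_eq_mul, smul_eq_mul, map_add, map_mul, map_mul, hφ, hφ]
  · have hzw : φ z = w := hji (by rw [hφ, hw])
    change j (D (φ z)) = j (D w)
    rw [hzw]

end Generic

section Transform

variable {K : Type*} [Field K]

/-- **The key estimate.** Let `R ⊆ K` be local, `0 ≠ u₀ ∈ 𝔪_R`, `δ` a derivation of `R` with
`δ 𝔪_R ⊆ 𝔪_R`, `D` a derivation of an `R`-field `F` extending `δ` and `j : F → K` over `R`. Then
every element of `R₁ = (R[𝔪_R/u₀])_{𝔪_O ∩ R[𝔪_R/u₀]}` is `j w` with `j (D w) ∈ R₁`: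
for the generators, `D (y/u₀) = δ y/u₀ - (y/u₀)(δ u₀/u₀) ∈ R[𝔪_R/u₀]` as `δ y, δ u₀ ∈ 𝔪_R`;
then ring closure and the quotient rule. [folklore] -/
private theorem forall_exists_of_mem_locAtCentre (O : ValuationSubring K) {R : Subring K}
    [IsLocalRing R] {u₀ : R} (hu₀ : u₀ ∈ maximalIdeal R) (h0 : u₀ ≠ 0) {δ : Derivation ℤ R R}
    (hδ : ∀ x ∈ maximalIdeal R, δ x ∈ maximalIdeal R) {S F : Type*} [CommRing S] [Field F]
    [Algebra S F] [Algebra R F] {D : Derivation S F F} {j : F →+* K}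
    (hj : ∀ r : R, j (algebraMap R F r) = r)
    (hD : ∀ r : R, D (algebraMap R F r) = algebraMap R F (δ r)) :
    ∀ z ∈ locAtCentre (blowupRing R (u₀ : K)) O, ∃ w : F,
      j (D w) ∈ locAtCentre (blowupRing R (u₀ : K)) O ∧ j w = z := by
  obtain ⟨T, hT⟩ := exists_subring_forall_mem_iff j D (locAtCentre (blowupRing R (u₀ : K)) O)
  have hB : blowupRing R (u₀ : K) ≤ locAtCentre (blowupRing R (u₀ : K)) O := le_locAtCentre _ O
  have hu0K : ((u₀ : R) : K) ≠ 0 := fun e => h0 (Subtype.ext e)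
  -- the generators `r ∈ R`
  have h1 : ∀ r : R, algebraMap R F r ∈ T := fun r =>
    (hT _).mpr ⟨by rw [hj]; exact hB (le_blowupRing R _ r.2),
      by rw [hD, hj]; exact hB (le_blowupRing R _ (δ r).2)⟩
  -- the generators `y / u₀`, `y ∈ 𝔪_R`
  have h2 : ∀ y ∈ maximalIdeal R, algebraMap R F y / algebraMap R F u₀ ∈ T := fun y hy => by
    refine (hT _).mpr ⟨by rw [map_div₀, hj, hj]; exact hB (div_mem_blowupRing _ hy), ?_⟩
    have key : j (D (algebraMap R F y / algebraMap R F u₀)) =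
        (δ y : K) / u₀ - (y : K) / u₀ * ((δ u₀ : K) / u₀) := by
      rw [Derivation.leibniz_div, hD, hD]
      simp only [smul_eq_mul, map_mul, map_pow, map_inv₀, map_sub, hj]
      field_simp
    rw [key]
    exact hB (sub_mem (div_mem_blowupRing _ (hδ y hy))
      (mul_mem (div_mem_blowupRing _ hy) (div_mem_blowupRing _ (hδ u₀ hu₀))))
  -- hence all of `R[𝔪_R/u₀]`
  have h3 : blowupRing R (u₀ : K) ≤ T.map j := by
    refine Subring.closure_le.mpr ?_
    rintro z (hz | ⟨y, hy, rfl⟩)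
    · exact ⟨algebraMap R F ⟨z, hz⟩, h1 ⟨z, hz⟩, hj ⟨z, hz⟩⟩
    · exact ⟨_, h2 y hy, by rw [map_div₀, hj, hj]⟩
  -- and all quotients with denominators of value `1`
  rintro z ⟨a, ha, b, hb, hvb, rfl⟩
  obtain ⟨wa, hwa, rfl⟩ := h3 ha
  obtain ⟨wb, hwb, rfl⟩ := h3 hb
  exact ⟨wa / wb, (div_mem_and ((hT _).mp hwa) ((hT _).mp hwb)
    (inv_mem_locAtCentre (hB hb) hvb)).2, map_div₀ j wa wb⟩

end Transform

/-- **H4: logarithmic derivations extend to the quadratic transform along a valuation.** If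
`R₁ = (R[𝔪/u₀])_{𝔪_O ∩ R[𝔪/u₀]}` is the quadratic transform of the local ring `R ⊆ K` along
`O` and `δ ∈ Der_ℤ(R)` satisfies `δ 𝔪 ⊆ 𝔪`, then `δ` extends to `δ₁ ∈ Der_ℤ(R₁)`: extend `δ`
to `Frac R`, where `δ (y/u₀) = δ y/u₀ - (y/u₀)(δ u₀/u₀) ∈ R[𝔪/u₀]`, and use the quotient rule
on the localisation (`forall_exists_of_mem_locAtCentre`, `exists_derivation_of_forall_exists`).
[folklore] -/
theorem exists_derivation_quadraticTransformAlong : ∀ {K : Type} [Field K] (O : ValuationSubring K) (R R₁ : Subring K) [IsLocalRing R] (h : Literature.AlgebraicGeometry.Resolution.IsQuadraticTransformAlong O R R₁) (δ : Derivation ℤ R R), (∀ x ∈ maximalIdeal R, δ x ∈ maximalIdeal R) → ∃ δ₁ : Derivation ℤ R₁ R₁, ∀ x : R, δ₁ (Subring.inclusion h.le x) = Subring.inclusion h.le (δ x) := by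
  intro K _ O R R₁ _ h δ hδ
  obtain ⟨_, u₀, hu₀, h0, -, hR₁⟩ := h.exists_eq_locAtCentre
  subst hR₁
  obtain ⟨D, hD⟩ :=
    exists_derivation_extend_of_isLocalization ℤ (FractionRing R) (nonZeroDivisors R) δ
  have hinj : Function.Injective (algebraMap R K) := fun a b hab => Subtype.ext hab
  have hj : ∀ r : R, IsFractionRing.lift hinj (algebraMap R (FractionRing R) r) = r := fun r =>
    IsFractionRing.lift_algebraMap hinj r
  have key := forall_exists_of_mem_locAtCentre O hu₀ h0 hδ hj hD
  obtain ⟨δ₁, hδ₁⟩ := exists_derivation_of_forall_exists (IsFractionRing.lift hinj) D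
    (locAtCentre (blowupRing R (u₀ : K)) O) fun z => key z z.2
  refine ⟨δ₁, fun x => Subtype.ext ?_⟩
  rw [hδ₁ (Subring.inclusion h.le x) (algebraMap R (FractionRing R) x) (hj x), hD, hj]
  rfl

end Summit.ResolutionOfSingularities.ResolutionOfSingularities.Theorems.PfaffLine
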